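import Literature.NumberTheory.LocalFields.UnramifiedQuadraticNormResidueShift
import Literature.NumberTheory.Automorphic.UnitaryThreeBorelCosetCountQuadratic   -- ★ A-p03: `natCard_subtype_comp_eq_mul` (counting through a map with constant fibres)
import HarnessLib

/-!
# The pair count of Flicker's Prop. 13, cases (c)∕(e): `#{(u, x) : N((uσ̄u)⁻¹ + e + x) ≡ e² − 1 (mod 𝔪^j)} = q^{m−1}(q+1) · (q+1)q^{2m−j−1}` — FILE 8 of the
# story `UnramifiedQuadraticNorm*`
(Flicker (1998), *Elementary proof of the fundamental lemma for a unitary group*, Prop. 13 p. 93, case (c); Serre, *Local Fields*, V §2)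

Topic `NumberTheory/LocalFields`, namespace `Literature.NumberTheory.LocalFields.UnramifiedQuadraticNorm`.  THEOREMS ONLY: no definition, no named fact, no instance, no
notation, no `sorry`; kernel lane.  Cell `pub/hodgecm-mathlib`, road «D-N7-inert» ∕ MAP v3, brick «PROP. 13 (13-ii) COUNT-0» FILE J3b (pen F0P3b-p01 (g6) under A-p03 (g24)
pen 1; census `F0/P3/F0P3b-p01/g6/CENSUS-F8-Prop13-CountZero-X1.F0P3bp01g6.md` §0 (ce)).  HC_CM is proved only modulo the 2 remaining named inputs (hLiu418, h413) until rung 0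
closes; this file is elementary local-ring counting and proves no letter.

SETTING (as FILE 7): complete DVR `R`, `|R ⧸ 𝔪| = q²`, involution `σ` with an antisymmetric unit, `2 ∈ R^×`, `σ`-fixed uniformiser `ϖ`.  In `A = R ⧸ 𝔪^m` every class
splits uniquely as FIXED + ANTI-FIXED (`½(z + σ̄z) + ½(z − σ̄z)`).  THE COUNT (Flicker p. 93 (c), after CORE-0's criterion `|zσz − (f² − 1)| ≤ |ϖ^{2m−N}|`,
`z = n⁻¹ + f + x`, `n = uσu` — p04 (g12) `conditions_iff_norm_sub_le_of_near`): for `e ∈ R^σ` with `e² − 1 = ϖ^{2ℓ}γ`, `γ ∈ (R^σ)^×`, `2ℓ < j ≤ m`, the pairs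
`(u, x) ∈ A²` with `u` a unit, `σ̄x = −x` and `N((uσ̄u)⁻¹ + ē + x) ≡ ϖ^{2ℓ}γ (mod 𝔪^j)` number **`q^{m−1}(q+1) · (q^{(m−ℓ)−(j−2ℓ)} · q^{m−ℓ−1}(q+1))`**: the map
`(u, x) ↦ z = (uσ̄u)⁻¹ + ē + x` has fibres of size `q^{m−1}(q+1)` (a norm fibre, ★ `natCard_norm_fibre_quotient_pow`; `x` is the anti-fixed part of `z`) and its image
contains every `z` with `N(z) ≡ e² − 1 (mod 𝔪^j)` — for such `z` the fixed part minus `ē` is a UNIT (else `x̄² ≡ 1 (mod 𝔪̄)`, i.e. `x ≡ ±1`, absurd for an anti-fixed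
class when `2` is a unit) — whose number is ★ FILE 7 `natCard_norm_congr_shift`.  With `j = 2m − N`, `2ℓ = M − N` and the `N₀`-fibre `q^m`: `(1+q⁻¹)²q^{2m+N}` (★ `iThirteen` (c)).

## References
* [Flicker1998UnitaryFL] Y. Z. Flicker, *Elementary proof of the fundamental lemma for a unitary group*, Canad. J. Math. 50 (1998), 74–98: Prop. 13 p. 93.
* [Serre1979] J.-P. Serre, *Local Fields*, GTM 67 (1979), Ch. V §2 Prop. 2–3.
-/

set_option autoImplicit false

namespace Literature.NumberTheory.LocalFields.UnramifiedQuadraticNorm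

open Literature.LinearAlgebra.Matrix.HermitianFormsHensel Literature.NumberTheory.GaloisRepresentations IsLocalRing

universe u

variable {R : Type u} [CommRing R] (σ : R →+* R)

/-! ## §1 Fixed∕anti-fixed splitting and the unit claim in a local ring with `2` invertible -/

section Local

variable {A : Type u} [CommRing A] [IsLocalRing A] (τ : A →+* A) (hτ : ∀ a, τ (τ a) = a) (h2 : IsUnit (2 : A))

include hτ h2 in
/-- **The fixed part minus `e` is a unit** when `N(z) − (e² − 1)` is a non-unit, `2 ∈ A^×` (local ring `A`, involution `τ`): writing `z = f + x` with `τf = f`,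
`τx = −x`, if `f − e` were a non-unit then `1 − x² = (N z − (e²−1)) − (f−e)(f+e) ` would be a non-unit, so `1 − x` or `1 + x` is, and applying `τ` both are — whence `2` is.
[cite: Flicker1998UnitaryFL, Prop. 13 p. 93] -/
theorem isUnit_fixed_sub_of_norm_sub (e f x : A) (hτf : τ f = f) (hτx : τ x = -x)
    (hN : ¬ IsUnit ((f + x) * τ (f + x) - (e ^ 2 - 1))) : IsUnit (f - e) := by
  by_contra hfe
  have hmem : f - e ∈ maximalIdeal A := (mem_maximalIdeal _).2 hfe
  have hNmem : (f + x) * τ (f + x) - (e ^ 2 - 1) ∈ maximalIdeal A := (mem_maximalIdeal _).2 hN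
  -- `1 − x² = (N z − (e² − 1)) − (f − e)(f + e)`
  have hx2 : 1 - x ^ 2 ∈ maximalIdeal A := by
    have h : 1 - x ^ 2 = ((f + x) * τ (f + x) - (e ^ 2 - 1)) - (f - e) * (f + e) := by
      rw [map_add, hτf, hτx]; ring
    rw [h]
    exact Ideal.sub_mem _ hNmem (Ideal.mul_mem_right _ _ hmem)
  have hprod : (1 - x) * (1 + x) ∈ maximalIdeal A := by
    have : (1 - x) * (1 + x) = 1 - x ^ 2 := by ring
    rw [this]; exact hx2
  have h2m : (2 : A) ∉ maximalIdeal A := fun h => (mem_maximalIdeal _).1 h h2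
  have hτnu : ∀ y : A, ¬ IsUnit y → ¬ IsUnit (τ y) := fun y hy hu => hy (by have h := hu.map τ; rwa [hτ] at h)
  rcases Ideal.IsPrime.mem_or_mem (IsLocalRing.maximalIdeal.isMaximal A).isPrime hprod with h1 | h1
  · -- `1 − x ∈ 𝔪` and `τ(1 − x) = 1 + x ∈ 𝔪`
    have h1' : 1 + x ∈ maximalIdeal A := by
      have := hτnu (1 - x) ((mem_maximalIdeal _).1 h1)
      rw [map_sub, map_one, hτx, sub_neg_eq_add] at this
      exact (mem_maximalIdeal _).2 this
    apply h2m
    have : (2 : A) = (1 - x) + (1 + x) := by ring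
    rw [this]; exact Ideal.add_mem _ h1 h1'
  · have h1' : 1 - x ∈ maximalIdeal A := by
      have := hτnu (1 + x) ((mem_maximalIdeal _).1 h1)
      rw [map_add, map_one, hτx, ← sub_eq_add_neg] at this
      exact (mem_maximalIdeal _).2 this
    apply h2m
    have : (2 : A) = (1 - x) + (1 + x) := by ring
    rw [this]; exact Ideal.add_mem _ h1' h1

omit [IsLocalRing A] in
include h2 in
/-- Uniqueness of the splitting FIXED + ANTI-FIXED when `2` is a unit. [cite: Serre1979, Ch. V §2] -/
theorem fixed_add_anti_inj {F F' X X' : A} (hF : τ F = F) (hF' : τ F' = F') (hX : τ X = -X) (hX' : τ X' = -X') (h : F + X = F' + X') :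
    F = F' ∧ X = X' := by
  obtain ⟨two, htwo⟩ := h2
  have hτ' : F - X = F' - X' := by
    have := congrArg τ h; rw [map_add, map_add, hF, hF', hX, hX'] at this; simpa [sub_eq_add_neg] using this
  have hF2 : (2 : A) * F = 2 * F' := by linear_combination h + hτ'
  have hX2 : (2 : A) * X = 2 * X' := by linear_combination h - hτ'
  have h2u : IsUnit (2 : A) := ⟨two, htwo⟩
  exact ⟨h2u.mul_left_cancel hF2, h2u.mul_left_cancel hX2⟩

end Local

/-! ## §2 The pair count -/

section Count

variable [IsDomain R] [IsDiscreteValuationRing R] [Finite (ResidueField R)] [IsAdicComplete (maximalIdeal R) R]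
  (hσ : ∀ a, σ (σ a) = a) {a : R} (ha : IsUnit (σ a - a)) {q : ℕ} (hq : Nat.card (ResidueField R) = q ^ 2) (h2 : IsUnit (2 : R))

include ha hq h2 in
/-- **THE PAIR COUNT OF PROP. 13, CASES (c)∕(e)** (`ρ_m`-currency): for `2ℓ < j ≤ m`, `1 ≤ m`, `e ∈ R^σ` with `e² − 1 = ϖ^{2ℓ}γ` (`γ ∈ (R^σ)^×`, `ϖ` a `σ`-fixed uniformiser),
`#{(u, x) ∈ (R ⧸ 𝔪^m)² : u ∈ (R⧸𝔪^m)^×, σ̄x = −x, N((uσ̄u)⁻¹ + ē + x) ≡ ϖ^{2ℓ}γ (mod 𝔪^j)} = q^{m−1}(q+1) · (q^{(m−ℓ)−(j−2ℓ)} · q^{m−ℓ−1}(q+1))` — the map `(u,x) ↦ z = (uσ̄u)⁻¹ + ē + x`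
has norm-fibre fibres (`x` = anti-fixed part of `z`, `uσ̄u` = inverse of the fixed part minus `ē`, a unit by `isUnit_fixed_sub_of_norm_sub`) over exactly the classes counted by
★ `natCard_norm_congr_shift`.  Flicker p. 93 (c): «`(1 − q⁻²)(1 − q⁻¹)⁻¹ q^{4m} q^{−(M−N)} ∫ δ(Nz ∈ 1 + π^{2m−M}R) dz` … `= (1 + q⁻¹)² q^{2m+N}`» (after the `N₀`-fibre `q^m`).
[cite: Flicker1998UnitaryFL, Prop. 13 p. 93] [cite: Serre1979, Ch. V §2 Prop. 3] -/
theorem natCard_pairs_norm_congr_shift {p : R} (hp : Irreducible p) (hσp : σ p = p) {m j ℓ : ℕ} (hm : 1 ≤ m) (hj : 2 * ℓ < j) (hjm : j ≤ m)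
    {e γ : R} (hσe : σ e = e) (hγ : IsUnit γ) (hσγ : σ γ = γ) (hec : e ^ 2 - 1 = p ^ (2 * ℓ) * γ) :
    Nat.card {ux : (R ⧸ maximalIdeal R ^ m) × (R ⧸ maximalIdeal R ^ m) // IsUnit ux.1 ∧
      Ideal.quotientMap (maximalIdeal R ^ m) σ (maximalIdeal_pow_le_comap σ hσ m) ux.2 = -ux.2 ∧
      Ideal.Quotient.factor (Ideal.pow_le_pow_right hjm)
        ((Ring.inverse (ux.1 * Ideal.quotientMap (maximalIdeal R ^ m) σ (maximalIdeal_pow_le_comap σ hσ m) ux.1) +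
            Ideal.Quotient.mk (maximalIdeal R ^ m) e + ux.2) *
          Ideal.quotientMap (maximalIdeal R ^ m) σ (maximalIdeal_pow_le_comap σ hσ m)
            (Ring.inverse (ux.1 * Ideal.quotientMap (maximalIdeal R ^ m) σ (maximalIdeal_pow_le_comap σ hσ m) ux.1) +
              Ideal.Quotient.mk (maximalIdeal R ^ m) e + ux.2)) =
        Ideal.Quotient.mk (maximalIdeal R ^ j) (p ^ (2 * ℓ) * γ)} =
      (q ^ (m - 1) * (q + 1)) * (q ^ ((m - ℓ) - (j - 2 * ℓ)) * (q ^ ((m - ℓ) - 1) * (q + 1))) := by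
  classical
  haveI := CompleteLocalRing.finite_quotient_maximalIdeal_pow (R := R) m
  set A := R ⧸ maximalIdeal R ^ m with hA
  set τ := Ideal.quotientMap (maximalIdeal R ^ m) σ (maximalIdeal_pow_le_comap σ hσ m) with hτ
  set φ := Ideal.Quotient.factor (S := maximalIdeal R ^ m) (T := maximalIdeal R ^ j) (Ideal.pow_le_pow_right hjm) with hφ
  have hττ : ∀ z, τ (τ z) = z := quotientMap_quotientMap σ hσ m
  have hτmk : ∀ w : R, τ (Ideal.Quotient.mk _ w) = Ideal.Quotient.mk _ (σ w) := fun w => Ideal.quotientMap_mk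
  haveI : Nontrivial A := nontrivial_quotient_pow (R := R) hm
  haveI : IsLocalRing A := IsLocalRing.of_surjective' (Ideal.Quotient.mk (maximalIdeal R ^ m)) Ideal.Quotient.mk_surjective
  have h2A : IsUnit (2 : A) := by have h := h2.map (Ideal.Quotient.mk (maximalIdeal R ^ m)); rwa [map_ofNat] at h
  have hτinv : ∀ w : Aˣ, τ (w : A) = w → τ (↑w⁻¹ : A) = ↑w⁻¹ := fun w hw => by
    have h1 : τ (↑w⁻¹ : A) * (w : A) = 1 := by rw [← hw, ← map_mul, Units.inv_mul, map_one]
    calc τ (↑w⁻¹ : A) = τ ↑w⁻¹ * ((w : A) * ↑w⁻¹) := by rw [Units.mul_inv, mul_one]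
      _ = ↑w⁻¹ := by rw [← mul_assoc, h1, one_mul]
  have hq0 : 0 < q := by
    rcases Nat.eq_zero_or_pos q with h0 | h0
    · exfalso
      have h1 : 0 < Nat.card (ResidueField R) := Nat.card_pos
      rw [hq, h0] at h1; simp at h1
    · exact h0
  set eA : A := Ideal.Quotient.mk _ e with heA
  have hτe : τ eA = eA := by rw [heA, hτmk, hσe]
  -- the norm, the map `Z`, the predicate `G`
  let Nm : A → A := fun u => u * τ u
  have hNfix : ∀ u, τ (Nm u) = Nm u := fun u => by simp only [Nm, map_mul, hττ, mul_comm]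
  let α := {ux : A × A // IsUnit ux.1 ∧ τ ux.2 = -ux.2}
  let Z : α → A := fun w => Ring.inverse (Nm w.1.1) + eA + w.1.2
  let G : A → Prop := fun z => φ (z * τ z) = Ideal.Quotient.mk (maximalIdeal R ^ j) (p ^ (2 * ℓ) * γ)
  haveI : Finite α := Subtype.finite
  -- Step 0: reshuffle to `{w : α // G (Z w)}`
  have e0 : {ux : A × A // IsUnit ux.1 ∧ τ ux.2 = -ux.2 ∧ G (Ring.inverse (Nm ux.1) + eA + ux.2)} ≃ {w : α // G (Z w)} :=
    { toFun := fun w => ⟨⟨w.1, w.2.1, w.2.2.1⟩, w.2.2.2⟩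
      invFun := fun w => ⟨w.1.1, w.1.2.1, w.1.2.2, w.2⟩
      left_inv := fun w => rfl
      right_inv := fun w => rfl }
  rw [Nat.card_congr e0]
  -- fixed parts: `Ring.inverse (Nm u) + e` is `τ`-fixed
  have hfixZ : ∀ w : α, τ (Ring.inverse (Nm w.1.1) + eA) = Ring.inverse (Nm w.1.1) + eA := fun w => by
    rw [map_add, hτe]
    congr 1
    have hu : IsUnit (Nm w.1.1) := w.2.1.mul (w.2.1.map τ)
    rw [← hu.unit_spec, Ring.inverse_unit]
    exact hτinv hu.unit (by rw [hu.unit_spec]; exact hNfix _)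
  -- Step 1: fibres of `Z` are norm fibres
  have hfibre : ∀ z ∈ Set.range Z, Nat.card {w : α // Z w = z} = q ^ (m - 1) * (q + 1) := by
    rintro _ ⟨w₀, rfl⟩
    obtain ⟨⟨u₀, x₀⟩, hu₀, hx₀⟩ := w₀
    have hN₀ : IsUnit (Nm u₀) := hu₀.mul (hu₀.map τ)
    -- a σ-fixed unit lift of `Nm u₀`
    obtain ⟨v, hv⟩ := Ideal.Quotient.mk_surjective u₀
    have hvu : IsUnit v := isUnit_of_isUnit_mk_pow (R := R) hm (by rw [hv]; exact hu₀)
    have hr : Ideal.Quotient.mk (maximalIdeal R ^ m) (v * σ v) = Nm u₀ := by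
      show _ = u₀ * τ u₀; rw [← hv, hτmk, map_mul]
    have hrunit : IsUnit (v * σ v) := hvu.mul (hvu.map σ)
    have hσr : σ (v * σ v) = v * σ v := by rw [map_mul, hσ, mul_comm]
    rw [← natCard_norm_fibre_quotient_pow σ hσ ha hq hm hrunit hσr]
    refine Nat.card_congr
      { toFun := fun w => ⟨w.1.1.1, ?_⟩
        invFun := fun u => ⟨⟨(u.1, x₀), ?_, hx₀⟩, ?_⟩
        left_inv := fun w => ?_
        right_inv := fun u => rfl }
    · -- `Z w = Z w₀` forces `Nm w.u = Nm u₀`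
      have h := w.2
      change Ring.inverse (Nm w.1.1.1) + eA + w.1.1.2 = Ring.inverse (Nm u₀) + eA + x₀ at h
      obtain ⟨hF, -⟩ := fixed_add_anti_inj τ h2A (hfixZ w.1) (hfixZ ⟨(u₀, x₀), hu₀, hx₀⟩) w.1.2.2 hx₀ h
      have hinv : Ring.inverse (Nm w.1.1.1) = Ring.inverse (Nm u₀) := add_right_cancel hF
      have hNw : IsUnit (Nm w.1.1.1) := w.1.2.1.mul (w.1.2.1.map τ)
      have key : Nm w.1.1.1 = Nm u₀ := by
        rw [← Ring.inverse_inverse hNw, hinv, Ring.inverse_inverse hN₀]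
      show w.1.1.1 * τ w.1.1.1 = Ideal.Quotient.mk _ (v * σ v)
      rw [hr]; exact key
    · -- a norm-fibre element is a unit
      have h : u.1 * τ u.1 = Nm u₀ := u.2.trans hr
      exact isUnit_of_mul_isUnit_left (h ▸ hN₀)
    · show Ring.inverse (u.1 * τ u.1) + eA + x₀ = Ring.inverse (Nm u₀) + eA + x₀
      have h : u.1 * τ u.1 = Nm u₀ := u.2.trans hr
      rw [h]
    · apply Subtype.ext; apply Subtype.ext
      have h := w.2
      change Ring.inverse (Nm w.1.1.1) + eA + w.1.1.2 = Ring.inverse (Nm u₀) + eA + x₀ at h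
      obtain ⟨-, hX⟩ := fixed_add_anti_inj τ h2A (hfixZ w.1) (hfixZ ⟨(u₀, x₀), hu₀, hx₀⟩) w.1.2.2 hx₀ h
      exact Prod.ext rfl hX.symm
  rw [Literature.NumberTheory.Automorphic.UnitaryGroup.natCard_subtype_comp_eq_mul Z G _ hfibre]
  congr 1
  -- Step 2: every `z` with `G z` is in the range of `Z`
  have hrange : ∀ z, G z → z ∈ Set.range Z := by
    intro z hz
    obtain ⟨i2, hi2⟩ := h2A
    set F : A := (↑i2⁻¹ : A) * (z + τ z) with hF
    set X : A := (↑i2⁻¹ : A) * (z - τ z) with hX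
    have h2i : (↑i2⁻¹ : A) * 2 = 1 := by rw [← hi2, Units.inv_mul]
    have hτi : τ (↑i2⁻¹ : A) = ↑i2⁻¹ := hτinv i2 (by rw [hi2, map_ofNat])
    have hFfix : τ F = F := by rw [hF, map_mul, hτi, map_add, hττ, add_comm]
    have hXanti : τ X = -X := by rw [hX, map_mul, hτi, map_sub, hττ]; ring
    have hzFX : z = F + X := by
      rw [hF, hX, ← mul_add]; linear_combination (-(z)) * h2i
    -- the fixed part minus `e` is a unit
    have hGz : ¬ IsUnit ((F + X) * τ (F + X) - (eA ^ 2 - 1)) := by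
      rw [← hzFX]
      intro hu
      have hj1 : 1 ≤ j := by omega
      haveI : Nontrivial (R ⧸ maximalIdeal R ^ j) := nontrivial_quotient_pow (R := R) hj1
      have hzero : φ (z * τ z - (eA ^ 2 - 1)) = 0 := by
        rw [map_sub, hz, heA, map_sub, map_pow, map_one, hφ, Ideal.Quotient.factor_mk, ← map_pow, ← map_one (Ideal.Quotient.mk _), ← map_sub, ← hec, sub_self]
      exact not_isUnit_zero (hzero ▸ hu.map φ)
    have hFe : IsUnit (F - eA) := isUnit_fixed_sub_of_norm_sub τ hττ ⟨i2, hi2⟩ eA F X hFfix hXanti hGz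
    -- `n₁ := (F − e)⁻¹`, a fixed unit; pick `u` with `Nm u = n₁`
    set n₁ : A := ↑hFe.unit⁻¹ with hn₁
    have hn₁fix : τ n₁ = n₁ := by
      have h1 : τ (F - eA) = F - eA := by rw [map_sub, hFfix, hτe]
      rw [hn₁]; exact hτinv hFe.unit (by rw [hFe.unit_spec]; exact h1)
    obtain ⟨r₀, hr₀⟩ := Ideal.Quotient.mk_surjective n₁
    have hmem : σ r₀ - r₀ ∈ maximalIdeal R ^ m := by
      rw [← Ideal.Quotient.eq_zero_iff_mem, map_sub, sub_eq_zero, ← hτmk, hr₀, hn₁fix]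
    obtain ⟨r, hrfix, hrr⟩ := exists_fixed_sub_mem σ hσ ha hmem
    have hrn : Ideal.Quotient.mk (maximalIdeal R ^ m) r = n₁ := by
      rw [← hr₀, Ideal.Quotient.eq]; exact hrr
    have hru : IsUnit r := isUnit_of_isUnit_mk_pow (R := R) hm (by rw [hrn, hn₁]; exact Units.isUnit _)
    have hpos : 0 < Nat.card {u : A // u * τ u = Ideal.Quotient.mk _ r} := by
      rw [natCard_norm_fibre_quotient_pow σ hσ ha hq hm hru hrfix]; exact Nat.mul_pos (pow_pos hq0 _) (Nat.succ_pos q)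
    obtain ⟨⟨u, hu⟩⟩ := Nat.card_pos_iff.1 hpos |>.1
    rw [hrn] at hu
    have huunit : IsUnit u := isUnit_of_mul_isUnit_left (by rw [show u * τ u = n₁ from hu, hn₁]; exact Units.isUnit _)
    refine ⟨⟨(u, X), huunit, hXanti⟩, ?_⟩
    show Ring.inverse (u * τ u) + eA + X = z
    rw [show u * τ u = n₁ from hu, hn₁, Ring.inverse_unit, inv_inv, hFe.unit_spec, sub_add_cancel, hzFX]
  rw [Nat.card_congr (Equiv.subtypeEquivRight fun z => (and_iff_right_of_imp (hrange z) : z ∈ Set.range Z ∧ G z ↔ G z))]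
  -- Step 3: the `z`-count
  exact natCard_norm_congr_shift σ hσ ha hq hp hσp hj hjm hγ hσγ

end Count

end Literature.NumberTheory.LocalFields.UnramifiedQuadraticNorm
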